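/- Copyright: D-0145 ideator seat `ym-r3-idea-2` (planner, generation g18, LENS «nearmiss»), crux `HistoryTailL`
(stmt-QuantumFields-19936) ∕ sibling PATH-B row `FirstExitWindowTailL` (stmt-QuantumFields-26243).  Released under the licence of the
surrounding project. -/
import Summits.QuantumFields.YangMills.Theorems.FirstExitWindowFirstExitWindowTailLFirstExitOne
import Summits.QuantumFields.YangMills.Theorems.FirstExitWindowFirstExitWindowTailLDepthRate
import HarnessLib

/-!
# RUNG «depth-blame»: the averaged-plaquette tail at EVERY depth with a GEOMETRIC rate — the near-miss of the
# first-exit window tail, typed (statement + proof plan; NOT a line, NOT a registry object)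

WHAT THIS FILE IS.  A rung ∕ witness-of-weakness SIGNATURE for the PATH-B row `FirstExitWindow.FirstExitWindowTailL`
(stmt-QuantumFields-26243, this seat's g2 crux; row `h26243` of ✓`…RunPairOrganRung.ym3TorusSU2_of_runPairOrganRows`, RECORD 17bp) and,
through ✓`FirstExitWindow.unitScaleTilt_historyTailL_of_firstExitDeep`, for `UnitScaleTilt.HistoryTailL` (stmt-QuantumFields-19936).
It records IN THE KERNEL'S LETTERS the measured deficit of the one elementary mechanism that is landed on this row — the BLAME
mechanism of ✓`FirstExitWindow.stub_firstExitOne` (p614089, depth `j = 1`) — when it is run at every depth: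

* ✓ `stub_depthRateTail` — **PROVED** (v3): ✓p761703 `Summit.QuantumFields.YangMills.Theorems.FirstExitWindow.depthRateTail` (ym3-torus-px17
  g10, 2026-08-30T04:57Z; statement identical by script; `--supports stmt-QuantumFields-26243 --as helper`); this file has NO `sorry` any more: for every block size `L` and profile ceiling
  `(b₀, p₀)` there are `γ₁ ∈ (0,1]`, `C ≥ 0`, `c > 0`, a RATE `0 < λ ≤ 1` and a power `N` such that for every d = 3 family `F`
  (`F.L = L`), every `0 < γ ≤ γ₁`, every cut-off `K`, EVERY depth `j ≤ K`, every threshold profile `0 < b ≤ b₀` and every level-`j`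
  plaquette `p`:
  `Gibbs_K{ θ_b(K−j) ≤ |Ū^j(∂p) − 1| } ≤ C^(j+1) · β_(K−j)^N · exp(−c · λ^(2j) · p_b(g_(K−j))²)`,
  `β_h = (γL^(−h))⁻¹ = g_h⁻²`, `θ_b(h) = g_h·p_b(g_h)`, `p_b = B10.pFun b p₀` (NO history condition at all: the bare law of the `j`-fold
  (0.4)-average).  Explicit witnesses from the plan: `N = 5`, `c = 1∕4`, `C = max(L² + 45L³, 2e^24·c₀⁻³)·L^5`,
  `λ = λ_L := √L ∕ W`, `W = L² + 6(5L)² + 1` (the cruder `√L ∕ ((1 + ½·log L)^p₀ · W)` also works) — so `λ_L < 1` for every `L ≥ 1`: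
  the rate is GENUINELY geometric (`λ_L² ≍ L^(−3)∕151²`: the blame loses three powers of `L` per level, cf. DEFICIT-LEDGER row E).
* ✓ `firstExitDeep_depthRate` (PROVED here from the stub, monotonicity only): the registered deep stub's EVENT (`stub_firstExitDeep` of
  26243: all finer levels `θ_(b₀)`-small ∧ level `j` `θ_(b₂)`-small ∧ `θ_(b₀)(K−j) ≤ |Ū^j(∂p) − 1|`, `2 ≤ j ≤ K`) has Gibbs mass
  `≤ C^(j+1)·β_(K−j)^N·exp(−c·λ^(2j)·p_(b₀)(g_(K−j))²)`.

THE NEAR-MISS, EXACTLY.  `stub_firstExitDeep` (the open half of 26243) is the same sentence with `C^(j+1)·exp(−c·λ^(2j)·p²)` replaced by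
`C·exp(−c·p²)`: THE SINGLE INPUT TO IMPROVE IS THE RATE `λ_L^(2j) ↦ 1` (and `C^(j+1) ↦ C`, which any `c' < c` absorbs once the rate is
uniform, since `p_b(g_h)² ≥ b²(1 + ½·h·log L)^(2p₀)` … no: since `p² → ∞` only with the height, the factor `C^(j+1)` is NOT absorbed at
bounded height — both losses are real).  Summed over the history (`# level-j plaquettes ≍ 3·(2L^(F.m))³·L^(3(K−j))`), the rung controls
the history tail ONLY on the finest `j ≲ (p₀ ∕ log λ_L⁻¹)·log((K−j)·log L) ≍ (p₀∕(3 log L))·log((K−j) log L)` levels; the window parameter `m` of `HistoryTailAt` frees the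
COARSEST `K∕m` levels; the levels in between are the open content (the record rows EX ∕ (O‴χₛ) of `Lines/unbundled_v6.lean`, or PATH B's
`h26243`).  See `Cruxes/HistoryTailL/DEFICIT-LEDGER.md` (this generation) for the four other elementary currencies and their measured losses —
all of them avatars of the same scale entropy.

PROOF PLAN FOR `stub_depthRateTail` (induction on the depth `j`, two LANDED engines, no reflection positivity beyond the bare tail's own):
(base `j = 0`) lit ✓`T3FinestHeightTail.gibbsMeasure_real_dist1_ge_le` (`N := 2`): `Gibbs{θ ≤ |U(∂q) − 1|} ≤ 2e^24 c₀⁻³ (√β_K)^9 e^(−β_K θ²∕4)`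
at `θ = θ_b(K)`, with `β_K·θ_b(K)² = p_b(g_K)²` and `(√β_K)^9 ≤ β_K^5` (`β_K ≥ 1` from `γ ≤ 1`).
(step `j → j+1`) ✓`FirstExitWindow.exists_blame_finset` (stated for EVERY level: `Plaq P (j+1)` over `GaugeField P j`): if
`θ ≤ |Ū^(j+1)(∂p) − 1|` and the guard `((d+2)L)²∕4 · (θ∕W) < δ_SU(2)` holds, some `q` among `≤ L² + 45L³` blamed level-`j` plaquettes has
`θ∕W ≤ |Ū^j(∂q) − 1|` (contrapositive of the lemma with `a := θ∕W`; `Ū^(j+1) = avgFun ℰp (Ū^j)` by `Averaging.iter` ∕ `blockAvg_avg`).  With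
`θ = θ_b(h)`, `h = K − (j+1)`, RE-LABEL the blamed threshold `θ_b(h)∕W` as a window threshold one height up: with
`r_h := (1 + log g_h⁻¹)∕(1 + log g_(h+1)⁻¹) ∈ [(1 + ½ log L)⁻¹, 1]` (`g_(h+1) = g_h∕√L`, `g_h ≤ 1`) put `b' := b·√L·r_h^p₀ ∕ W`; then
`0 < b' ≤ b ≤ b₀` (`√L ≤ W`) and EXACTLY `θ_(b')(h+1) = θ_b(h)∕W`, `p_(b')(g_(h+1)) = (√L∕W)·p_b(g_h)` (`θBal_mul`: `θBal`∕`pFun` are linear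
in `b`; `θBal_eq`).  The induction hypothesis at depth `j` (which quantifies over ALL profiles `≤ b₀` — that is what the `∀ b` is for),
profile `b'`, gives each blamed event mass `≤ C^(j+1)·β_(h+1)^N·exp(−c·λ^(2j)·p_(b')(g_(h+1))²) = C^(j+1)·L^N·β_h^N·exp(−c·λ^(2j)·(L∕W²)·p_b(g_h)²)`
(`β_(h+1) = L·β_h`, cf. ✓`beta_height_one`; `λ² = L∕W²`); the union over the blamed set costs `L² + 45L³`, and `(L² + 45L³)·L^N ≤ C` closes
the step with `C^(j+2)`.  The guard is uniform: `(5L)²∕4·θ_b(h)∕W ≤ (5L)²∕4·θ_(b₀)(h) < δ_SU(2)` for `γ ≤ γ₁(L, b₀, p₀)` by lit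
✓`T3Thresholds.exists_gamma_forall_θBal_le` + `θBal_mul_le` (as in the `j = 1` file).  Helper identities all in tree: `iter_succ_apply` ∕
`iter_zero_apply` (T4Spectator), `θBal_mul`, `θBal_mul_le` (T3InteriorExcision), `pFun_sq_eq` (BalabanAdmissibleClassParams:
`p_b(g_j)² = L^j∕γ·θ_b(j)²`, i.e. `β_j·θ_b(j)² = p_b(g_j)²`), `θBal_pos`.  Size: M (≈ 250 lines on top of the `j = 1` file's §1–§2; the `j = 1`
proof ll. 239–368 is the template for both the base and the step).  Companion plan card: `Cruxes/HistoryTailL/RungDepthBlame.md`.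
PRESEARCH: «multi-level large-field tail geometric rate block averaging» ∕ «blame cascade averaged plaquette» — corpus (fts + vec): the only
uniform-rate statement in print is Bałaban's (71) [corpus:Balaban1985UV3 p.273] (via the full small-field expansion); no elementary
depth-dependent statement found (queries in `DEFICIT-LEDGER.md` §4); galaxy: no hits for "large field|block averaging tail" beyond the
Bałaban ∕ Dimock corpus.  Folklore-grade; the value is the kernel statement of the deficit, not novelty.

HONEST SCOPE.  A RUNG file (v3: sorry-free — `stub_depthRateTail := depthRateTail`, ✓p761703); it is nobody's registered stub (this file is NOT a
skeleton of any crux, concludes no crux decl, and changes no registry); `firstExitDeep_depthRate` is proved from it by monotonicity only.  Nothing of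
Bałaban's renormalisation-group estimates is asserted; `FirstExitWindowTailL`, `HistoryTailL`, PATH A, PATH B and rung R3 (SU(2) YM₃ on T³ —
Bałaban's ultraviolet limit, existence AND uniqueness; NOT d = 4, NOT infinite volume, NOT a mass gap, NOT Clay) stay exactly as open as
before.  No summit and no rung is proved by this file or by any line of this seat.
References: [Balaban1985Averaging] CMP 98 (1985) Prop. 1 (51) p.26; [Balaban1985UV3] CMP 102 (1985) (7) p.257, (71) p.273;
[FrohlichIsraelLiebSimon1978] Thm 4.1 (engine of the bare tail).
-/

set_option autoImplicit false

noncomputable section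

open MeasureTheory

namespace Summit.QuantumFields.YangMills.Cruxes.HistoryTailL.DepthBlame

open Literature.MathematicalPhysics.QuantumFieldTheory.Balaban1983to89
open Literature.MathematicalPhysics.QuantumFieldTheory.Balaban1983to89.T3ContinuumYM3Torus
open Literature.MathematicalPhysics.QuantumFieldTheory.Balaban1983to89.T3UnitScaleTilt
open Literature.MathematicalPhysics.QuantumFieldTheory.Balaban1983to89.T3UnitLawDensityEML (ℰp)

/-- ★ **RUNG «depth-blame» — the `j`-fold averaged-plaquette tail at every depth with geometric rate `λ^(2j)`** (TO BE PROVED by the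
induction of the module docstring; v3: the proof IS ✓p761703 `…Theorems.FirstExitWindow.depthRateTail`).  For every `L`, `(b₀, p₀)` there are
`γ₁ ∈ (0,1]`, `C ≥ 0`, `c > 0`, `0 < λ ≤ 1`, `N` with: for every family `F` (`F.L = L`), `0 < γ ≤ γ₁`, every `K`, every depth `j ≤ K`, every
threshold profile `0 < b ≤ b₀` and every level-`j` plaquette `p`,
`Gibbs_K{θ_b(K−j) ≤ |Ū^j(∂p) − 1|} ≤ C^(j+1)·β_(K−j)^N·exp(−c·λ^(2j)·p_b(g_(K−j))²)`.
[cite: Balaban1985UV3, (71) p.273 (the uniform-rate statement this rung falls short of); Balaban1985Averaging, Prop. 1 (51) p.26] -/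
theorem stub_depthRateTail :
    ∀ (L : ℕ) (b₀ p₀ : ℝ), 0 < b₀ → 2 < p₀ → ∃ (γ₁ C c lam : ℝ) (N : ℕ), 0 < γ₁ ∧ γ₁ ≤ 1 ∧ 0 < c ∧ 0 ≤ C ∧ 0 < lam ∧ lam ≤ 1 ∧
      ∀ (F : T3Family) (γ : ℝ), F.L = L → 0 < γ → γ ≤ γ₁ → ∀ (K j : ℕ), j ≤ K → ∀ (b : ℝ), 0 < b → b ≤ b₀ →
        ∀ p : Plaq (F.P K) j,
          (gibbsK F ℰp γ K).real {U | θBal F.L γ b p₀ (K - j) ≤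
              GaugeGroup.dist1 (GaugeField.plaqHol
                (Averaging.iter (fun i => BlockAveraging.blockAvg (P := F.P K) (j := i) ℰp) j U) p)} ≤
            C ^ (j + 1) * ((γ * ((F.L : ℝ)⁻¹) ^ (K - j))⁻¹) ^ N *
              Real.exp (-(c * lam ^ (2 * j) * B10.pFun b p₀ (Real.sqrt (γ * ((F.L : ℝ)⁻¹) ^ (K - j))) ^ 2)) :=
  Summit.QuantumFields.YangMills.Theorems.FirstExitWindow.depthRateTail

/-- ✓ **The registered deep stub's event at the depth rate** (proved from `stub_depthRateTail` by monotonicity of the Gibbs mass: the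
first-exit window event is contained in the bare tail event of the same plaquette).  Compare `stub_firstExitDeep` of
stmt-QuantumFields-26243: identical quantifier block and event, bound `C·β^N·exp(−c·p²)` there versus `C^(j+1)·β^N·exp(−c·λ^(2j)·p²)`
here — the rate `λ^(2j) ↦ 1` (and `C^(j+1) ↦ C`) is the single input this rung does not supply. [folklore] -/
theorem firstExitDeep_depthRate :
    ∀ (L : ℕ) (b₀ p₀ b₂ : ℝ), 0 < b₀ → 2 < p₀ → b₀ ≤ b₂ → ∃ (γ₁ C c lam : ℝ) (N : ℕ), 0 < γ₁ ∧ γ₁ ≤ 1 ∧ 0 < c ∧ 0 ≤ C ∧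
      0 < lam ∧ lam ≤ 1 ∧
      ∀ (F : T3Family) (γ : ℝ), F.L = L → 0 < γ → γ ≤ γ₁ → ∀ (K j : ℕ), 2 ≤ j → j ≤ K → ∀ p : Plaq (F.P K) j,
        (gibbsK F ℰp γ K).real {U | (∀ k, k < j → PlaqSmall (θBal F.L γ b₀ p₀ (K - k))
            (Averaging.iter (fun i => BlockAveraging.blockAvg (P := F.P K) (j := i) ℰp) k U)) ∧
          PlaqSmall (θBal F.L γ b₂ p₀ (K - j))
            (Averaging.iter (fun i => BlockAveraging.blockAvg (P := F.P K) (j := i) ℰp) j U) ∧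
          θBal F.L γ b₀ p₀ (K - j) ≤ GaugeGroup.dist1 (GaugeField.plaqHol
            (Averaging.iter (fun i => BlockAveraging.blockAvg (P := F.P K) (j := i) ℰp) j U) p)} ≤
          C ^ (j + 1) * ((γ * ((F.L : ℝ)⁻¹) ^ (K - j))⁻¹) ^ N *
            Real.exp (-(c * lam ^ (2 * j) * B10.pFun b₀ p₀ (Real.sqrt (γ * ((F.L : ℝ)⁻¹) ^ (K - j))) ^ 2)) := by
  intro L b₀ p₀ b₂ hb₀ hp₀ _hb₂
  obtain ⟨γ₁, C, c, lam, N, hγ₁, hγ₁1, hc, hC, hlam, hlam1, h⟩ := stub_depthRateTail L b₀ p₀ hb₀ hp₀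
  refine ⟨γ₁, C, c, lam, N, hγ₁, hγ₁1, hc, hC, hlam, hlam1, ?_⟩
  intro F γ hFL hγ hγγ₁ K j _hj2 hjK p
  haveI := isProbabilityMeasure_gibbsK F ℰp hγ.le K
  refine le_trans (measureReal_mono ?_ (measure_ne_top _ _)) (h F γ hFL hγ hγγ₁ K j hjK b₀ hb₀ le_rfl p)
  intro U hU
  exact hU.2.2

end Summit.QuantumFields.YangMills.Cruxes.HistoryTailL.DepthBlame

end
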